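import Summits.QuantumAdvantage.QuantumAdvantage.Theorems.LinnikCubicClassGroupsDegreeOnePrimesEscapeConjInvariantPNT
import Summits.QuantumAdvantage.QuantumAdvantage.Theorems.LinnikCubicClassGroupsDegreeOnePrimesEscapeDivisionPNTPiCongr
import HarnessLib

/-!
# The Chebotarev PNT for conjugation-invariant sets: arbitrary prime predicates (ramified primes absorbed)

Topic `Summits/QuantumAdvantage/QuantumAdvantage/Theorems`, cell B2b-1 (linnik-cubic), PART A (gen 14);
helper toward the crux `DegreeOnePrimesEscape` (stmt-QuantumAdvantage-11543) of route
`LinnikCubicClassGroups`.  HONEST FRAMING: the value of this file is a THEOREM (kernel-checked, GRH-free,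
Siegel-free, no hypothesis) — NOT summit progress.

`conjInvariant_PNT_pi` counts the primes `p ≤ x`, `p ∤ d_N`, whose Frobenius class lies in a
conjugation-invariant `S ⊆ Gal(N/ℚ)`.  Consumers count primes by an arithmetic condition `P(p)` (a splitting
type in a subfield, a residue condition, …) which agrees with the Frobenius condition only at the primes
`p ∤ d_N`.  At most `2 log|d_N|` primes divide `d_N`, and for NONEMPTY `S` the main term is
`≫ x |d_N|^{−2(1+n²)}/log x` even at the exceptional zero (Stark, `exceptional_mainTerm_ge`), so the
ramified primes are absorbed into the relative error in the Linnik range: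

* `conjInvariant_PNT_pi_congr` — for `n > 1`, `0 < ε ≤ 1` there are `L, c > 0` (`c ≤ 1/4`) such that every
  Galois `N` of degree `n` carries `θ ∈ {0,1}`, `β₁`, `K₁ ⊴ G` as in `conjInvariant_PNT_pi`, and for every
  nonempty conjugation-invariant `S`, EVERY predicate `P` with `P(p) ↔ Frob_p ∈ S` at the primes `p ∤ d_N`,
  and every `x ≥ |d_N|^L`: `|#{p ≤ x : P(p)} − M_S(x)| ≤ ε M_S(x)`,
  `M_S(x) = (|S| Li(x) − θ (|S ∩ K₁| − |S ∖ K₁|) Li(x^{β₁}))/|G|`.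
[cite: LagariasMontgomeryOdlyzko1979, Theorem 1.1] [cite: ThornerZaman2019, Theorem 1.4]
-/

noncomputable section

open scoped NumberField nonZeroDivisors
open Finset Real Ideal NumberField
open Literature.NumberTheory.NumberFields Literature.NumberTheory.LFunctions
  Literature.NumberTheory.LFunctions.NumberField

namespace Summit.QuantumAdvantage.QuantumAdvantage.Theorems.DegreeOnePrimesEscape

set_option maxHeartbeats 4000000 in
/-- **The Chebotarev prime number theorem in the Linnik range for a conjugation-invariant set and an
arbitrary prime predicate agreeing with the Frobenius condition at the unramified primes** (see the module
docstring).  Unconditional. [cite: LagariasMontgomeryOdlyzko1979, Theorem 1.1]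
[cite: ThornerZaman2019, Theorem 1.4] -/
theorem conjInvariant_PNT_pi_congr (n : ℕ) (hn : 1 < n) {ε : ℝ} (hε : 0 < ε) (hε1 : ε ≤ 1) :
    ∃ L c : ℝ, 0 < L ∧ 0 < c ∧ c ≤ 1 / 4 ∧ ∀ (N : Type) [Field N] [NumberField N] [IsGalois ℚ N],
      Module.finrank ℚ N = n →
      ∃ (θ β₁ : ℝ) (K₁ : Subgroup (N ≃ₐ[ℚ] N)), (θ = 0 ∨ θ = 1) ∧ K₁.Normal ∧
        1 - c / (Real.log ((NumberField.discr N).natAbs : ℝ) + Real.log 4) < β₁ ∧ β₁ < 1 ∧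
        (θ = 1 → dedekindZeta₁ N β₁ = 0 ∧ K₁.index = 2 ∧
          ∀ H : Subgroup (N ≃ₐ[ℚ] N),
            dedekindZeta₁ (IntermediateField.fixedField H) β₁ = 0 ↔ H ≤ K₁) ∧
        (θ = 0 → K₁ = ⊤ ∧ ¬ ∃ β : ℝ, dedekindZeta₁ N β = 0 ∧
          1 - c / (Real.log ((NumberField.discr N).natAbs : ℝ) + Real.log 4) < β ∧ β < 1) ∧
        ∀ S : Set (N ≃ₐ[ℚ] N), (∀ g h : N ≃ₐ[ℚ] N, g ∈ S → h * g * h⁻¹ ∈ S) → S.Nonempty →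
          ∀ (P : ℕ → Prop) [DecidablePred P],
            (∀ p : ℕ, p.Prime → ¬ ((p : ℤ) ∣ NumberField.discr N) →
              (P p ↔ ∃ (Q : Ideal (𝓞 N)) (_ : Q.IsMaximal) (_ : Q.LiesOver (span {(p : ℤ)}))
                (φ : N ≃ₐ[ℚ] N), IsArithFrobAt ℤ φ Q ∧ Q.inertia (N ≃ₐ[ℚ] N) = ⊥ ∧ φ ∈ S)) →
            ∀ x : ℝ, ((NumberField.discr N).natAbs : ℝ) ^ L ≤ x →
              |((((Nat.primesLE ⌊x⌋₊).filter P).card : ℕ) : ℝ) -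
                ((Nat.card S : ℝ) * offsetLogIntegral x -
                  θ * ((Nat.card {g : N ≃ₐ[ℚ] N // g ∈ S ∧ g ∈ K₁} : ℝ) -
                    Nat.card {g : N ≃ₐ[ℚ] N // g ∈ S ∧ g ∉ K₁}) * offsetLogIntegral (x ^ β₁)) /
                  Nat.card (N ≃ₐ[ℚ] N)| ≤
                ε * (((Nat.card S : ℝ) * offsetLogIntegral x -
                  θ * ((Nat.card {g : N ≃ₐ[ℚ] N // g ∈ S ∧ g ∈ K₁} : ℝ) -
                    Nat.card {g : N ≃ₐ[ℚ] N // g ∈ S ∧ g ∉ K₁}) * offsetLogIntegral (x ^ β₁)) /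
                  Nat.card (N ≃ₐ[ℚ] N)) := by
  classical
  have hn0 : (0 : ℝ) < n := by exact_mod_cast (lt_trans Nat.zero_lt_one hn)
  set ε₀ : ℝ := ε / 2 with hε₀
  have hε₀0 : 0 < ε₀ := by positivity
  have hε₀1 : ε₀ ≤ 1 := by rw [hε₀]; linarith
  obtain ⟨L₀, c, hL₀, hc, hc4, h⟩ := conjInvariant_PNT_pi n hn hε₀0 hε₀1
  obtain ⟨c₁, hc₁, hc₁1, hMT⟩ := exceptional_mainTerm_ge n hn
  set e : ℝ := (1 : ℝ) + n * n with he
  set K : ℝ := 16 * n / (ε * c₁) with hK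
  have hK1 : 1 ≤ K := by
    rw [hK, le_div_iff₀ (by positivity)]
    have hn1 : (1 : ℝ) ≤ n := by exact_mod_cast hn.le
    nlinarith [mul_le_mul hε1 hc₁1 hc₁.le zero_le_one]
  obtain ⟨L, hL, hthr⟩ := pi_thresholds L₀ (e + 1 / 2) hK1
  refine ⟨L, c, hL, hc, hc4, fun N _ _ _ hN => ?_⟩
  obtain ⟨θ, β₁, K₁, hθ, hK₁n, hβ₁c, hβ₁1, h1, h0, hS⟩ := h N hN
  refine ⟨θ, β₁, K₁, hθ, hK₁n, hβ₁c, hβ₁1, h1, h0, fun S hSinv hSne P _ hP x hx => ?_⟩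
  have hN1 : 1 < Module.finrank ℚ N := by rw [hN]; exact hn
  set d : ℝ := ((NumberField.discr N).natAbs : ℝ) with hd
  have hd3 : (3 : ℝ) ≤ d := three_le_natAbs_discr_real N hN1
  have hd0 : (0 : ℝ) < d := by linarith
  have hd1 : (1 : ℝ) ≤ d := by linarith
  have hG : (Nat.card (N ≃ₐ[ℚ] N) : ℝ) = n := by
    rw [IsGalois.card_aut_eq_finrank, hN]
  -- `|S| ≥ 1`, `|S| = |S ∩ K₁| + |S ∖ K₁|`
  have hS1 : (1 : ℝ) ≤ Nat.card S := by
    haveI : Nonempty S := hSne.to_subtype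
    exact_mod_cast Nat.one_le_iff_ne_zero.mpr (Nat.card_pos (α := S)).ne'
  have hcs : (Nat.card S : ℝ) = (Nat.card {g : N ≃ₐ[ℚ] N // g ∈ S ∧ g ∈ K₁} : ℝ) +
      Nat.card {g : N ≃ₐ[ℚ] N // g ∈ S ∧ g ∉ K₁} := by
    exact_mod_cast natCard_set_eq_add S K₁
  have hSp0 : (0 : ℝ) ≤ Nat.card {g : N ≃ₐ[ℚ] N // g ∈ S ∧ g ∈ K₁} := Nat.cast_nonneg _
  have hSm0 : (0 : ℝ) ≤ Nat.card {g : N ≃ₐ[ℚ] N // g ∈ S ∧ g ∉ K₁} := Nat.cast_nonneg _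
  set Pgood : ℕ → Prop := fun p : ℕ => ¬ ((p : ℤ) ∣ NumberField.discr N) ∧
      ∃ (Q : Ideal (𝓞 N)) (_ : Q.IsMaximal) (_ : Q.LiesOver (span {(p : ℤ)})) (φ : N ≃ₐ[ℚ] N),
        IsArithFrobAt ℤ φ Q ∧ Q.inertia (N ≃ₐ[ℚ] N) = ⊥ ∧ φ ∈ S with hPgood
  -- the perturbation: `|π_P(x) − π_S(x)| ≤ #{p ≤ x : p ∣ d_N} ≤ 2 log d`
  have hpert : |((((Nat.primesLE ⌊x⌋₊).filter P).card : ℕ) : ℝ) -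
      (((Nat.primesLE ⌊x⌋₊).filter Pgood).card : ℕ)| ≤ 2 * Real.log d := by
    refine le_trans (abs_card_filter_sub_card_filter_le (Nat.primesLE ⌊x⌋₊) P Pgood
      (fun p : ℕ => (p : ℤ) ∣ NumberField.discr N) fun p hp hR => ?_) ?_
    · rw [hP p (Nat.mem_primesLE.mp hp).2 hR, hPgood]
      exact ⟨fun h1 => ⟨hR, h1⟩, fun h1 => h1.2⟩
    · convert card_filter_primesLE_dvd_discr_le N ⌊x⌋₊ using 3
  -- thresholds at `x ≥ d^L`
  obtain ⟨hx256, hxL₀, hx16, hKx⟩ := hthr d hd3 x hx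
  have hx1 : (1 : ℝ) < x := by linarith
  have hx0 : 0 < x := by linarith
  have hlogx0 : 0 < Real.log x := by linarith
  have hD0 : 0 < d ^ (2 * e) := Real.rpow_pos_of_pos hd0 _
  have hD1 : 1 ≤ d ^ (2 * e) := Real.one_le_rpow hd1 (by positivity)
  -- the absorption inequality: `2 log d ≤ ε₀ · (1/n) · (x c₁/(4 d^{2e} log x))`
  have habs : ∀ M : ℝ, 1 / (n : ℝ) * (x * c₁ / (4 * d ^ (2 * e)) / Real.log x) ≤ M →
      2 * Real.log d ≤ ε₀ * M := by
    intro M hM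
    have hsx : Real.sqrt x * Real.sqrt x = x := Real.mul_self_sqrt hx0.le
    have hsx4 : 4 * Real.sqrt x ≤ x := by
      have h16 : 16 ≤ Real.sqrt x := by
        rw [show (16 : ℝ) = Real.sqrt 256 by
          rw [show (256 : ℝ) = 16 ^ 2 by norm_num, Real.sqrt_sq (by norm_num)]]
        exact Real.sqrt_le_sqrt hx256
      nlinarith
    have hsplit : d ^ (2 * (e + 1 / 2)) = d ^ (2 * e) * d := by
      rw [show 2 * (e + 1 / 2) = 2 * e + 1 by ring, Real.rpow_add hd0, Real.rpow_one]
    have hKx' := hKx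
    rw [hsplit, hK] at hKx'
    have h1' : 16 * n * (d ^ (2 * e) * d) * Real.log x ≤ ε * c₁ * (4 * Real.sqrt x) := by
      rw [show 16 * (n : ℝ) / (ε * c₁) * (d ^ (2 * e) * d) * Real.log x =
        (16 * n * (d ^ (2 * e) * d) * Real.log x) / (ε * c₁) by ring, div_le_iff₀ (by positivity)] at hKx'
      linarith
    have h2 : 16 * n * (d ^ (2 * e) * d) * Real.log x ≤ ε * c₁ * x := by
      have := mul_le_mul_of_nonneg_left hsx4 (show 0 ≤ ε * c₁ by positivity)
      linarith
    have hlogd : Real.log d ≤ d := (Real.log_le_sub_one_of_pos hd0).trans (by linarith)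
    have h3 : 2 * Real.log d ≤ ε₀ * (1 / (n : ℝ) * (x * c₁ / (4 * d ^ (2 * e)) / Real.log x)) := by
      rw [hε₀, show ε / 2 * (1 / (n : ℝ) * (x * c₁ / (4 * d ^ (2 * e)) / Real.log x)) =
        (ε * c₁ * x) / (8 * n * d ^ (2 * e) * Real.log x) by field_simp; ring,
        le_div_iff₀ (by positivity)]
      have h4 : 2 * Real.log d * (8 * n * d ^ (2 * e) * Real.log x) =
          Real.log d * (16 * n * d ^ (2 * e) * Real.log x) := by ring
      rw [h4]
      calc Real.log d * (16 * n * d ^ (2 * e) * Real.log x)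
          ≤ d * (16 * n * d ^ (2 * e) * Real.log x) :=
            mul_le_mul_of_nonneg_right hlogd (by positivity)
        _ = 16 * n * (d ^ (2 * e) * d) * Real.log x := by ring
        _ ≤ ε * c₁ * x := h2
    exact h3.trans (mul_le_mul_of_nonneg_left hM hε₀0.le)
  -- `W' ≤ Li(x)`
  have hLi : x * c₁ / (4 * d ^ (2 * e)) / Real.log x ≤ offsetLogIntegral x := by
    refine le_trans ?_ (div_two_mul_log_le_offsetLogIntegral hx256)
    rw [div_div, div_le_div_iff₀ (by positivity) (by positivity)]
    nlinarith [mul_le_mul_of_nonneg_left hD1 hx0.le, mul_pos hx0 hlogx0]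
  have hmain := hS S hSinv x hxL₀
  -- the lower bound for the main term: `M_S(x) ≥ (1/n) W'`
  have hδn : 1 / (n : ℝ) ≤ (Nat.card S : ℝ) / Nat.card (N ≃ₐ[ℚ] N) := by
    rw [hG]; exact div_le_div_of_nonneg_right hS1 hn0.le
  have hMS : 1 / (n : ℝ) * (x * c₁ / (4 * d ^ (2 * e)) / Real.log x) ≤
      ((Nat.card S : ℝ) * offsetLogIntegral x -
        θ * ((Nat.card {g : N ≃ₐ[ℚ] N // g ∈ S ∧ g ∈ K₁} : ℝ) -
          Nat.card {g : N ≃ₐ[ℚ] N // g ∈ S ∧ g ∉ K₁}) * offsetLogIntegral (x ^ β₁)) /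
        Nat.card (N ≃ₐ[ℚ] N) := by
    have hW0 : 0 ≤ x * c₁ / (4 * d ^ (2 * e)) / Real.log x := by positivity
    rcases hθ with hθ0 | hθ1
    · rw [hθ0]
      have e1 : ((Nat.card S : ℝ) * offsetLogIntegral x -
          0 * ((Nat.card {g : N ≃ₐ[ℚ] N // g ∈ S ∧ g ∈ K₁} : ℝ) -
            Nat.card {g : N ≃ₐ[ℚ] N // g ∈ S ∧ g ∉ K₁}) * offsetLogIntegral (x ^ β₁)) /
          Nat.card (N ≃ₐ[ℚ] N) = (Nat.card S : ℝ) / Nat.card (N ≃ₐ[ℚ] N) * offsetLogIntegral x := by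
        ring
      rw [e1]
      exact mul_le_mul hδn hLi hW0 (le_trans (by positivity) hδn)
    · obtain ⟨hζ₁, -, -⟩ := h1 hθ1
      have hβ34 : 3 / 4 ≤ β₁ := three_quarters_le_of_window hc hc4 hd3 hβ₁c
      have hβ0 : 0 < β₁ := by linarith
      -- `W' ≤ Li(x) − Li(x^{β₁})`
      have hLi' : x * c₁ / (4 * d ^ (2 * e)) / Real.log x ≤
          offsetLogIntegral x - offsetLogIntegral (x ^ β₁) := by
        refine le_trans ?_ (sub_rpow_div_log_le_offsetLogIntegral_sub hx1 hβ0 hβ₁1.le)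
        apply div_le_div_of_nonneg_right _ hlogx0.le
        have h1' := hMT N hN β₁ hζ₁ hβ34 hβ₁1 x hx1 hx16
        have h2 : x ^ β₁ ≤ x ^ β₁ / β₁ := by
          rw [le_div_iff₀ hβ0]
          have := Real.rpow_pos_of_pos hx0 β₁
          nlinarith
        linarith
      -- `Li(x^{β₁}) ≥ 0`
      have hLiβ0 : 0 ≤ offsetLogIntegral (x ^ β₁) := by
        have h2 : (2 : ℝ) ≤ x ^ β₁ := by
          have h64 : (256 : ℝ) ^ (3 / 4 : ℝ) ≤ x ^ β₁ :=
            (Real.rpow_le_rpow (by norm_num) hx256 (by norm_num)).trans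
              (Real.rpow_le_rpow_of_exponent_le hx1.le hβ34)
          have : (2 : ℝ) ≤ (256 : ℝ) ^ (3 / 4 : ℝ) := by
            rw [show (256 : ℝ) = 4 ^ (4 : ℝ) by norm_num, ← Real.rpow_mul (by norm_num)]
            norm_num
          linarith
        have := offsetLogIntegralPow_nonneg 1 h2
        rwa [offsetLogIntegralPow_one] at this
      rw [hθ1]
      have hGpos : (0 : ℝ) < Nat.card (N ≃ₐ[ℚ] N) := by rw [hG]; exact hn0
      -- `M_S ≥ (|S|/|G|)(Li − Li_β) ≥ (1/n) W'`
      have hlow : (Nat.card S : ℝ) / Nat.card (N ≃ₐ[ℚ] N) *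
          (offsetLogIntegral x - offsetLogIntegral (x ^ β₁)) ≤
          ((Nat.card S : ℝ) * offsetLogIntegral x -
            1 * ((Nat.card {g : N ≃ₐ[ℚ] N // g ∈ S ∧ g ∈ K₁} : ℝ) -
              Nat.card {g : N ≃ₐ[ℚ] N // g ∈ S ∧ g ∉ K₁}) * offsetLogIntegral (x ^ β₁)) /
            Nat.card (N ≃ₐ[ℚ] N) := by
        rw [div_mul_eq_mul_div, div_le_div_iff_of_pos_right hGpos, hcs]
        nlinarith
      exact le_trans (mul_le_mul hδn hLi' hW0 (le_trans (by positivity) hδn)) hlow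
  have := abs_sub_le_of_perturb hmain hpert (habs _ hMS)
  rw [hε₀] at this
  convert this using 2; ring

end Summit.QuantumAdvantage.QuantumAdvantage.Theorems.DegreeOnePrimesEscape

end
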